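import Summits.AnomalousDissipation.AnomalousDissipation.Theorems.SawtoothPulseCascadeK1LocalisedCascadeMomentPeriodic
import Summits.AnomalousDissipation.AnomalousDissipation.Theorems.SawtoothPulseCascadeK1LocalisedCascadeCutoffSocketH

/-!
# K1loc, line `Spectral` / SeqCone — helper: THE PERIODIC-CELL MOMENT BOUND FOR THE CASCADE CUT-OFFS (S-B constants, (g1))

Helper file of the prover lane on the crux `K1LocalisedCascade` (stmt-AnomalousDissipation-19491), route
`SawtoothPulseCascade` (glue seat k1loc-p3, item (g1) of ad-k1loc-p2's 00:10:52Z list).  The strip cut-offs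
`X^± = sT((±U_j′ − (1−2ε))/ε)` are `1/N_j`-periodic and ALL their derivatives are supported in the open strips
`{1−2ε < ±U_j′ < 1−ε}`, which lie in the corner zone of measure `≤ 4Mδ_j/π` (`…ZoneMeasure`) as soon as `2e^{−M²/2} ≤ ε ≤ ½`.
Hence the cell integrals of `X′², X″²` are `≤ c₁²·4Mδ_j/π`, `≤ c₂²·4Mδ_j/π` (`c₁ = 2C₁(M+4)Λ_j`, `c₂ = (4C₂(M+4)²+2C₁(2M²+33))Λ_j²`,
`Λ_j = 2πN_j/δ_j`), and `…MomentPeriodic` gives the moment bound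
`Σ_q ω(q)‖𝓕(X^±∘x_l)(q)‖ ≤ ω₁·(1/2π)(√(2Q)·c₁√V + c₂√V/(N_jπ√(2Q)))`, `V = 4Mδ_j/π`, every `Q ≥ 1`
(`tsum_modulus_cutoff_le_periodic` / `_neg_`): of order `ω₁·M²Λ_j·√(Mδ_j)…` instead of `ω₁·Λ_j²`.  On the way: the second
derivative of the smooth step vanishes off the OPEN unit interval (`deriv_deriv_smoothTransition_eq_zero_of_not_mem_Ioo`), so
`X″ ≠ 0 ⇒ 1−2ε < ±U′ < 1−ε` (`mem_Ioo_of_deriv_deriv_cutoff_ne_zero`).  No definitions; no statement about the stub.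
[cite: ElgindiLissMattingly2025, §1 (corner strips)] [cite: Grafakos2014, Prop. 3.1.2 (5) and Prop. 3.2.7 (3)] [problem: turb]
-/

-- `Summit.<Summit>.<Problem>`: single-conjunct summit, the duplicate namespace segment is deliberate.
set_option linter.dupNamespace false

noncomputable section

namespace Summit.AnomalousDissipation.AnomalousDissipation.Theorems.SawtoothPulseCascade.K1Cutoff

open Set Filter Topology Real MeasureTheory UnitAddTorus
open scoped ContDiff
open Literature.Analysis Literature.Analysis.FunctionSpaces Literature.Analysis.FunctionSpaces.Torus
open Literature.Analysis.Calculus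
open Literature.Analysis.FluidPDE.SawtoothCascade Literature.Analysis.FluidPDE.SawtoothCascade.CascadeParams
open Summit.AnomalousDissipation.AnomalousDissipation.Theorems.SawtoothPulseCascade.K1Flat
open Summit.AnomalousDissipation.AnomalousDissipation.Theorems.SawtoothPulseCascade.K1Slot

/-! ## The second derivative of the smooth step vanishes off the open unit interval -/

/-- A function differentiable at `a` and constant on `(−∞, a]` has derivative `0` at `a`. [folklore] -/
theorem deriv_eq_zero_of_const_on_Iic {f : ℝ → ℝ} {a c : ℝ} (hf : DifferentiableAt ℝ f a) (h : ∀ y ≤ a, f y = c) :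
    deriv f a = 0 := by
  have h1 : HasDerivWithinAt f (deriv f a) (Iic a) a := hf.hasDerivAt.hasDerivWithinAt
  have h2 : HasDerivWithinAt f 0 (Iic a) a :=
    (hasDerivWithinAt_const a (Iic a) c).congr (fun y hy => h y hy) (h a le_rfl)
  exact (uniqueDiffWithinAt_Iic a).eq_deriv _ h1 h2

/-- A function differentiable at `a` and constant on `[a, ∞)` has derivative `0` at `a`. [folklore] -/
theorem deriv_eq_zero_of_const_on_Ici {f : ℝ → ℝ} {a c : ℝ} (hf : DifferentiableAt ℝ f a) (h : ∀ y, a ≤ y → f y = c) :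
    deriv f a = 0 := by
  have h1 : HasDerivWithinAt f (deriv f a) (Ici a) a := hf.hasDerivAt.hasDerivWithinAt
  have h2 : HasDerivWithinAt f 0 (Ici a) a :=
    (hasDerivWithinAt_const a (Ici a) c).congr (fun y hy => h y hy) (h a le_rfl)
  exact (uniqueDiffWithinAt_Ici a).eq_deriv _ h1 h2

/-- `sT′(x) = 0` for `x ∉ (0,1)`. [folklore] -/
theorem deriv_smoothTransition_eq_zero_of_not_mem_Ioo {x : ℝ} (hx : x ∉ Ioo (0 : ℝ) 1) :
    deriv smoothTransition x = 0 := by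
  rw [mem_Ioo, not_and_or, not_lt, not_lt] at hx
  rcases hx with hx | hx
  · exact deriv_smoothTransition_of_nonpos hx
  · exact deriv_smoothTransition_of_one_le hx

/-- **`sT″(x) = 0` for `x ∉ (0,1)`** (including the endpoints, where `sT′` is flat from one side). [folklore] -/
theorem deriv_deriv_smoothTransition_eq_zero_of_not_mem_Ioo {x : ℝ} (hx : x ∉ Ioo (0 : ℝ) 1) :
    deriv (deriv smoothTransition) x = 0 := by
  have hd : DifferentiableAt ℝ (deriv smoothTransition) x :=
    (contDiff_deriv_smoothTransition.differentiable (by simp)) x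
  rw [mem_Ioo, not_and_or, not_lt, not_lt] at hx
  rcases hx with hx | hx
  · exact deriv_eq_zero_of_const_on_Iic hd fun y hy => deriv_smoothTransition_of_nonpos (hy.trans hx)
  · exact deriv_eq_zero_of_const_on_Ici hd fun y hy => deriv_smoothTransition_of_one_le (hx.trans hy)

/-! ## The derivatives of a strip cut-off live in the open strip -/

/-- The derivative of the cut-off as a function. [folklore] -/
theorem deriv_cutoff_eq {V : ℝ → ℝ} (hV : Differentiable ℝ V) (ε : ℝ) :
    deriv (fun y => smoothTransition ((V y - (1 - 2 * ε)) / ε)) =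
      fun y => deriv smoothTransition ((V y - (1 - 2 * ε)) / ε) * (deriv V y / ε) :=
  funext fun y => (hasDerivAt_cutoff (hV y).hasDerivAt).deriv

/-- **If `X″(y) ≠ 0` for `X = sT((V − (1−2ε))/ε)` then `1 − 2ε < V(y) < 1 − ε`** (`V`, `V′` differentiable, `ε > 0`).
[folklore] -/
theorem mem_Ioo_of_deriv_deriv_cutoff_ne_zero {V : ℝ → ℝ} {ε : ℝ} (hε : 0 < ε) (hV : Differentiable ℝ V)
    (hV2 : Differentiable ℝ (deriv V)) {y : ℝ}
    (h : deriv (deriv fun y => smoothTransition ((V y - (1 - 2 * ε)) / ε)) y ≠ 0) :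
    1 - 2 * ε < V y ∧ V y < 1 - ε := by
  by_contra hcon
  apply h
  have hg : (V y - (1 - 2 * ε)) / ε ∉ Ioo (0 : ℝ) 1 := by
    rintro ⟨h0, h1⟩
    apply hcon
    constructor
    · have := (div_pos_iff_of_pos_right hε).mp h0; linarith
    · rw [div_lt_one hε] at h1; linarith
  rw [deriv_cutoff_eq hV ε]
  have hin : HasDerivAt (fun y => (V y - (1 - 2 * ε)) / ε) (deriv V y / ε) y := ((hV y).hasDerivAt.sub_const _).div_const ε
  have hA : HasDerivAt (fun y => deriv smoothTransition ((V y - (1 - 2 * ε)) / ε))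
      (deriv (deriv smoothTransition) ((V y - (1 - 2 * ε)) / ε) * (deriv V y / ε)) y :=
    ((contDiff_deriv_smoothTransition.differentiable (by simp)) _).hasDerivAt.comp y hin
  have hB : HasDerivAt (fun y => deriv V y / ε) (deriv (deriv V) y / ε) y := (hV2 y).hasDerivAt.div_const ε
  have hAB : HasDerivAt (fun y => deriv smoothTransition ((V y - (1 - 2 * ε)) / ε) * (deriv V y / ε))
      (deriv (deriv smoothTransition) ((V y - (1 - 2 * ε)) / ε) * (deriv V y / ε) * (deriv V y / ε) +
        deriv smoothTransition ((V y - (1 - 2 * ε)) / ε) * (deriv (deriv V) y / ε)) y := hA.mul hB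
  rw [hAB.deriv, deriv_deriv_smoothTransition_eq_zero_of_not_mem_Ioo hg,
    deriv_smoothTransition_eq_zero_of_not_mem_Ioo hg]
  ring

/-! ## Cell integrals of functions supported in a small set -/

/-- If `|f| ≤ D` everywhere and `f` vanishes off `Z`, then `∫_{(0,1]} f² ≤ D²·vol(Z ∩ (0,1])`. [folklore] -/
theorem setIntegral_sq_le_of_support {f : ℝ → ℝ} {D : ℝ} {Z : Set ℝ} (hZ : MeasurableSet Z) (hf : ∀ y, |f y| ≤ D)
    (hsupp : ∀ y, f y ≠ 0 → y ∈ Z) :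
    ∫ y in Ioc (0 : ℝ) 1, (f y) ^ 2 ≤ D ^ 2 * volume.real (Z ∩ Ioc (0 : ℝ) 1) := by
  have hD : 0 ≤ D := (abs_nonneg _).trans (hf 0)
  have hle : ∀ y, (f y) ^ 2 ≤ D ^ 2 * Z.indicator 1 y := by
    intro y
    by_cases hy : y ∈ Z
    · rw [indicator_of_mem hy, Pi.one_apply, mul_one, ← sq_abs]
      exact pow_le_pow_left₀ (abs_nonneg _) (hf y) 2
    · have : f y = 0 := by by_contra hne; exact hy (hsupp y hne)
      rw [this, indicator_of_notMem hy]; simp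
  have hfin : volume (Ioc (0 : ℝ) 1) ≠ ⊤ := by rw [Real.volume_Ioc]; exact ENNReal.ofReal_ne_top
  have hint1 : IntegrableOn (Z.indicator (1 : ℝ → ℝ)) (Ioc (0 : ℝ) 1) volume :=
    Integrable.indicator (integrableOn_const (C := (1 : ℝ)) hfin) hZ
  have hint2 : IntegrableOn (fun y => D ^ 2 * Z.indicator (1 : ℝ → ℝ) y) (Ioc (0 : ℝ) 1) volume :=
    Integrable.const_mul hint1 (D ^ 2)
  by_cases hint : IntegrableOn (fun y => (f y) ^ 2) (Ioc (0 : ℝ) 1) volume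
  · calc ∫ y in Ioc (0 : ℝ) 1, (f y) ^ 2 ≤ ∫ y in Ioc (0 : ℝ) 1, D ^ 2 * Z.indicator 1 y :=
          setIntegral_mono_on hint hint2 measurableSet_Ioc fun y _ => hle y
      _ = D ^ 2 * volume.real (Z ∩ Ioc (0 : ℝ) 1) := by
          rw [integral_const_mul, integral_indicator_one hZ, measureReal_restrict_apply hZ]
  · rw [integral_undef hint]; positivity

/-! ## The corner zone on `(0,1]` -/

variable (P : CascadeParams)

/-- The corner zone `{2e^{−M²/2} < |U_j′ − 1|, 2e^{−M²/2} < |U_j′ + 1|}` meets `(0,1]` in measure `≤ 4Mδ_j/π`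
(`M ≥ 1`, `Mδ_j ≤ π/2`). [cite: ElgindiLissMattingly2025, §1 (corner strips)] -/
theorem volume_real_zone_inter_Ioc_le {j : ℕ} (hδ : 0 < P.δ j) (hN : P.N j ≠ 0) {M : ℝ} (hM : 1 ≤ M)
    (hMδ : M * P.δ j ≤ Real.pi / 2) :
    volume.real ({y : ℝ | 2 * Real.exp (-(M ^ 2 / 2)) < |deriv (P.U j) y - 1| ∧
        2 * Real.exp (-(M ^ 2 / 2)) < |deriv (P.U j) y + 1|} ∩ Ioc (0 : ℝ) 1) ≤ 4 * M * P.δ j / Real.pi := by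
  have hz := volume_zone_le' P hδ hN hM hMδ
  have hsub : ({y : ℝ | 2 * Real.exp (-(M ^ 2 / 2)) < |deriv (P.U j) y - 1| ∧
      2 * Real.exp (-(M ^ 2 / 2)) < |deriv (P.U j) y + 1|} ∩ Ioc (0 : ℝ) 1) ⊆
      {y : ℝ | y ∈ Ico (0 : ℝ) 1 ∧ 2 * Real.exp (-(M ^ 2 / 2)) < |deriv (P.U j) y - 1| ∧
        2 * Real.exp (-(M ^ 2 / 2)) < |deriv (P.U j) y + 1|} ∪ {1} := by
    rintro y ⟨⟨h1, h2⟩, hy0, hy1⟩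
    rcases eq_or_lt_of_le hy1 with h | h
    · right; exact h
    · left; exact ⟨⟨hy0.le, h⟩, h1, h2⟩
  have hle : volume ({y : ℝ | 2 * Real.exp (-(M ^ 2 / 2)) < |deriv (P.U j) y - 1| ∧
      2 * Real.exp (-(M ^ 2 / 2)) < |deriv (P.U j) y + 1|} ∩ Ioc (0 : ℝ) 1) ≤ ENNReal.ofReal (4 * M * P.δ j / Real.pi) :=
    calc _ ≤ _ := measure_mono hsub
      _ ≤ _ := measure_union_le _ _
      _ ≤ ENNReal.ofReal (4 * M * P.δ j / Real.pi) + 0 := by rw [Real.volume_singleton]; exact add_le_add hz le_rfl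
      _ = _ := add_zero _
  rw [measureReal_def]
  exact ENNReal.toReal_le_of_le_ofReal (by positivity) hle

/-! ## Cell integrals of the derivatives of the cascade cut-offs -/

/-- **`∫_{(0,1]} (X⁺′)² ≤ c₁²·4Mδ_j/π` and `∫_{(0,1]} (X⁺″)² ≤ c₂²·4Mδ_j/π`** for `X⁺ = sT((U_j′ − (1−2ε))/ε)`,
`2e^{−M²/2} ≤ ε ≤ ½`, `M ≥ 1`, `Mδ_j ≤ π/2`. [cite: ElgindiLissMattingly2025, §1 (corner strips)] -/
theorem setIntegral_sq_derivs_cutoff_le {j : ℕ} (hδ : 0 < P.δ j) (hN : P.N j ≠ 0) {ε M C₁ C₂ : ℝ} (hε : 0 < ε)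
    (hε2 : ε ≤ 1 / 2) (hM : 1 ≤ M) (hMε : 2 * Real.exp (-(M ^ 2 / 2)) ≤ ε) (hMδ : M * P.δ j ≤ Real.pi / 2)
    (hC₁ : ∀ x, |deriv smoothTransition x| ≤ C₁) (hC₂ : ∀ x, |deriv (deriv smoothTransition) x| ≤ C₂) :
    (∫ y in Ioc (0 : ℝ) 1, (deriv (fun y => smoothTransition ((deriv (P.U j) y - (1 - 2 * ε)) / ε)) y) ^ 2 ≤
      (2 * C₁ * (M + 4) * (2 * Real.pi * P.N j / P.δ j)) ^ 2 * (4 * M * P.δ j / Real.pi)) ∧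
    ∫ y in Ioc (0 : ℝ) 1, (deriv (deriv fun y => smoothTransition ((deriv (P.U j) y - (1 - 2 * ε)) / ε)) y) ^ 2 ≤
      ((4 * C₂ * (M + 4) ^ 2 + 2 * C₁ * (2 * M ^ 2 + 33)) * (2 * Real.pi * P.N j / P.δ j) ^ 2) ^ 2 *
        (4 * M * P.δ j / Real.pi) := by
  have hMε' : Real.exp (-(M ^ 2 / 2)) ≤ 2 * ε := by linarith [Real.exp_pos (-(M ^ 2 / 2))]
  have hU1 : Differentiable ℝ (deriv (P.U j)) := (P.contDiff_deriv_U hδ (n := ⊤)).differentiable (by simp)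
  have hU2 : Differentiable ℝ (deriv (deriv (P.U j))) :=
    (contDiff_infty_iff_deriv.mp (P.contDiff_deriv_U hδ (n := ⊤))).2.differentiable (by simp)
  set Z : Set ℝ := {y : ℝ | 2 * Real.exp (-(M ^ 2 / 2)) < |deriv (P.U j) y - 1| ∧
    2 * Real.exp (-(M ^ 2 / 2)) < |deriv (P.U j) y + 1|} with hZ_def
  have hZm : MeasurableSet Z :=
    (isOpen_lt continuous_const ((hU1.continuous.sub continuous_const).abs)).measurableSet.inter
      (isOpen_lt continuous_const ((hU1.continuous.add continuous_const).abs)).measurableSet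
  have hzone : ∀ y, 1 - 2 * ε < deriv (P.U j) y ∧ deriv (P.U j) y < 1 - ε → y ∈ Z := by
    rintro y ⟨h1, h2⟩
    refine ⟨?_, ?_⟩
    · rw [abs_sub_comm, abs_of_pos (by linarith)]; linarith
    · rw [abs_of_pos (by linarith)]; linarith
  have hvol := volume_real_zone_inter_Ioc_le P hδ hN hM hMδ
  have hc₁0 : 0 ≤ (2 * C₁ * (M + 4) * (2 * Real.pi * P.N j / P.δ j)) ^ 2 := sq_nonneg _
  have hc₂0 : 0 ≤ ((4 * C₂ * (M + 4) ^ 2 + 2 * C₁ * (2 * M ^ 2 + 33)) * (2 * Real.pi * P.N j / P.δ j) ^ 2) ^ 2 :=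
    sq_nonneg _
  constructor
  · refine (setIntegral_sq_le_of_support hZm (fun y => abs_deriv_cutoff_deriv_U_le_of_layer P hδ hε hM hMε' hC₁ y)
      (fun y hy => hzone y (mem_Ioo_of_deriv_cutoff_ne_zero hε hU1 hy))).trans ?_
    exact mul_le_mul_of_nonneg_left hvol hc₁0
  · refine (setIntegral_sq_le_of_support hZm
      (fun y => abs_deriv_deriv_cutoff_deriv_U_le_of_layer P hδ hε hM hMε' hC₁ hC₂ y)
      (fun y hy => hzone y (mem_Ioo_of_deriv_deriv_cutoff_ne_zero hε hU1 hU2 hy))).trans ?_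
    exact mul_le_mul_of_nonneg_left hvol hc₂0

/-- The `X⁻` twin of `setIntegral_sq_derivs_cutoff_le`. [cite: ElgindiLissMattingly2025, §1 (corner strips)] -/
theorem setIntegral_sq_derivs_cutoff_neg_le {j : ℕ} (hδ : 0 < P.δ j) (hN : P.N j ≠ 0) {ε M C₁ C₂ : ℝ} (hε : 0 < ε)
    (hε2 : ε ≤ 1 / 2) (hM : 1 ≤ M) (hMε : 2 * Real.exp (-(M ^ 2 / 2)) ≤ ε) (hMδ : M * P.δ j ≤ Real.pi / 2)
    (hC₁ : ∀ x, |deriv smoothTransition x| ≤ C₁) (hC₂ : ∀ x, |deriv (deriv smoothTransition) x| ≤ C₂) :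
    (∫ y in Ioc (0 : ℝ) 1, (deriv (fun y => smoothTransition ((-deriv (P.U j) y - (1 - 2 * ε)) / ε)) y) ^ 2 ≤
      (2 * C₁ * (M + 4) * (2 * Real.pi * P.N j / P.δ j)) ^ 2 * (4 * M * P.δ j / Real.pi)) ∧
    ∫ y in Ioc (0 : ℝ) 1, (deriv (deriv fun y => smoothTransition ((-deriv (P.U j) y - (1 - 2 * ε)) / ε)) y) ^ 2 ≤
      ((4 * C₂ * (M + 4) ^ 2 + 2 * C₁ * (2 * M ^ 2 + 33)) * (2 * Real.pi * P.N j / P.δ j) ^ 2) ^ 2 *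
        (4 * M * P.δ j / Real.pi) := by
  have hMε' : Real.exp (-(M ^ 2 / 2)) ≤ 2 * ε := by linarith [Real.exp_pos (-(M ^ 2 / 2))]
  have hU1 : Differentiable ℝ (deriv (P.U j)) := (P.contDiff_deriv_U hδ (n := ⊤)).differentiable (by simp)
  have hU2 : Differentiable ℝ (deriv (deriv (P.U j))) :=
    (contDiff_infty_iff_deriv.mp (P.contDiff_deriv_U hδ (n := ⊤))).2.differentiable (by simp)
  have hV1 : Differentiable ℝ (fun y => -deriv (P.U j) y) := hU1.neg
  have hV2 : Differentiable ℝ (deriv fun y => -deriv (P.U j) y) := by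
    have : deriv (fun y => -deriv (P.U j) y) = fun y => -deriv (deriv (P.U j)) y := by
      funext y; exact deriv.neg
    rw [this]; exact hU2.neg
  set Z : Set ℝ := {y : ℝ | 2 * Real.exp (-(M ^ 2 / 2)) < |deriv (P.U j) y - 1| ∧
    2 * Real.exp (-(M ^ 2 / 2)) < |deriv (P.U j) y + 1|} with hZ_def
  have hZm : MeasurableSet Z :=
    (isOpen_lt continuous_const ((hU1.continuous.sub continuous_const).abs)).measurableSet.inter
      (isOpen_lt continuous_const ((hU1.continuous.add continuous_const).abs)).measurableSet
  have hzone : ∀ y, 1 - 2 * ε < -deriv (P.U j) y ∧ -deriv (P.U j) y < 1 - ε → y ∈ Z := by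
    rintro y ⟨h1, h2⟩
    refine ⟨?_, ?_⟩
    · rw [abs_sub_comm, abs_of_pos (by linarith)]; linarith
    · rw [abs_of_pos (by linarith)]; linarith
  have hvol := volume_real_zone_inter_Ioc_le P hδ hN hM hMδ
  have hc₁0 : 0 ≤ (2 * C₁ * (M + 4) * (2 * Real.pi * P.N j / P.δ j)) ^ 2 := sq_nonneg _
  have hc₂0 : 0 ≤ ((4 * C₂ * (M + 4) ^ 2 + 2 * C₁ * (2 * M ^ 2 + 33)) * (2 * Real.pi * P.N j / P.δ j) ^ 2) ^ 2 :=
    sq_nonneg _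
  constructor
  · refine (setIntegral_sq_le_of_support hZm
      (fun y => abs_deriv_cutoff_neg_deriv_U_le_of_layer P hδ hε hM hMε' hC₁ y)
      (fun y hy => hzone y (mem_Ioo_of_deriv_cutoff_ne_zero (V := fun y => -deriv (P.U j) y) hε hV1 hy))).trans ?_
    exact mul_le_mul_of_nonneg_left hvol hc₁0
  · refine (setIntegral_sq_le_of_support hZm
      (fun y => abs_deriv_deriv_cutoff_neg_deriv_U_le_of_layer P hδ hε hM hMε' hC₁ hC₂ y)
      (fun y hy => hzone y (mem_Ioo_of_deriv_deriv_cutoff_ne_zero (V := fun y => -deriv (P.U j) y) hε hV1 hV2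
        hy))).trans ?_
    exact mul_le_mul_of_nonneg_left hvol hc₂0

/-! ## Periodicity of the cut-offs and the moment bound -/

/-- `U_j′(y + 1/N_j) = U_j′(y)`. [cite: ElgindiLissMattingly2025, §1.2.2] -/
theorem deriv_U_add_inv_N {j : ℕ} (hN : P.N j ≠ 0) (y : ℝ) : deriv (P.U j) (y + 1 / P.N j) = deriv (P.U j) y := by
  have hN' : (P.N j : ℝ) ≠ 0 := Nat.cast_ne_zero.2 hN
  have h : y + 1 / P.N j = (y + 1 / (2 * P.N j)) + 1 / (2 * P.N j) := by field_simp; ring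
  rw [h, deriv_U_add_half_period P hN, deriv_U_add_half_period P hN, neg_neg]

variable {d : Type*} [Fintype d] [DecidableEq d]

/-- **Periodic-cell moment bound for `X⁺_j`**: for a profile `X` with `X(y) = sT((U_j′(y) − (1−2ε))/ε)`
(`2e^{−M²/2} ≤ ε ≤ ½`, `M ≥ 1`, `Mδ_j ≤ π/2`), every modulus `ω` as in `…SpectralMoments.modulus_of_fibre_lipschitz`
(`ω₁ ≥ 0`) and every `Q ≥ 1`:
`Σ_q ω(q)‖𝓕(X∘x_l)(q)‖ ≤ ω₁·(1/2π)(√(2Q)·√(c₁²V) + √(c₂²V)/(N_jπ√(2Q)))`, `V = 4Mδ_j/π`.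
[cite: Grafakos2014, Prop. 3.1.2 (5) and Prop. 3.2.7 (3)] -/
theorem tsum_modulus_cutoff_le_periodic {j : ℕ} (hδ : 0 < P.δ j) (hN : P.N j ≠ 0) {ε M C₁ C₂ : ℝ} (hε : 0 < ε)
    (hε2 : ε ≤ 1 / 2) (hM : 1 ≤ M) (hMε : 2 * Real.exp (-(M ^ 2 / 2)) ≤ ε) (hMδ : M * P.δ j ≤ Real.pi / 2)
    (hC₁ : ∀ x, |deriv smoothTransition x| ≤ C₁) (hC₂ : ∀ x, |deriv (deriv smoothTransition) x| ≤ C₂)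
    (X : ShearProfile) (hX : ∀ y, X y = smoothTransition ((deriv (P.U j) y - (1 - 2 * ε)) / ε)) (l : d)
    {M₀ ω₁ : ℝ} (hω₁ : 0 ≤ ω₁) {Q : ℕ} (hQ : 1 ≤ Q) :
    (Summable fun q : d → ℤ => (if (∀ l', l' ≠ l → q l' = 0) then ω₁ * |(q l : ℝ)| else 2 * M₀) *
      ‖mFourierCoeff (fun x : UnitAddTorus d => ((X.onCircle (x l) : ℝ) : ℂ)) q‖) ∧
    ∑' q : d → ℤ, (if (∀ l', l' ≠ l → q l' = 0) then ω₁ * |(q l : ℝ)| else 2 * M₀) *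
      ‖mFourierCoeff (fun x : UnitAddTorus d => ((X.onCircle (x l) : ℝ) : ℂ)) q‖ ≤
      ω₁ * (1 / (2 * Real.pi) * (Real.sqrt (2 * Q) *
        Real.sqrt ((2 * C₁ * (M + 4) * (2 * Real.pi * P.N j / P.δ j)) ^ 2 * (4 * M * P.δ j / Real.pi)) +
        Real.sqrt (((4 * C₂ * (M + 4) ^ 2 + 2 * C₁ * (2 * M ^ 2 + 33)) * (2 * Real.pi * P.N j / P.δ j) ^ 2) ^ 2 *
          (4 * M * P.δ j / Real.pi)) / ((P.N j : ℝ) * (Real.pi * Real.sqrt (2 * Q))))) := by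
  have hXf : (⇑X : ℝ → ℝ) = fun y => smoothTransition ((deriv (P.U j) y - (1 - 2 * ε)) / ε) := funext hX
  obtain ⟨h1, h2⟩ := setIntegral_sq_derivs_cutoff_le P hδ hN hε hε2 hM hMε hMδ hC₁ hC₂
  rw [← hXf] at h1 h2
  have hXN : ∀ y, X (y + 1 / P.N j) = X y := fun y => by rw [hX, hX, deriv_U_add_inv_N P hN]
  have hN1 : 1 ≤ P.N j := Nat.one_le_iff_ne_zero.mpr hN
  exact tsum_modulus_mul_norm_mFourierCoeff_onCircle_le_periodic X l hN1 hXN hω₁ h1 h2 hQ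

/-- **Periodic-cell moment bound for `X⁻_j`** (`X(y) = sT((−U_j′(y) − (1−2ε))/ε)`).
[cite: Grafakos2014, Prop. 3.1.2 (5) and Prop. 3.2.7 (3)] -/
theorem tsum_modulus_cutoff_neg_le_periodic {j : ℕ} (hδ : 0 < P.δ j) (hN : P.N j ≠ 0) {ε M C₁ C₂ : ℝ} (hε : 0 < ε)
    (hε2 : ε ≤ 1 / 2) (hM : 1 ≤ M) (hMε : 2 * Real.exp (-(M ^ 2 / 2)) ≤ ε) (hMδ : M * P.δ j ≤ Real.pi / 2)
    (hC₁ : ∀ x, |deriv smoothTransition x| ≤ C₁) (hC₂ : ∀ x, |deriv (deriv smoothTransition) x| ≤ C₂)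
    (X : ShearProfile) (hX : ∀ y, X y = smoothTransition ((-deriv (P.U j) y - (1 - 2 * ε)) / ε)) (l : d)
    {M₀ ω₁ : ℝ} (hω₁ : 0 ≤ ω₁) {Q : ℕ} (hQ : 1 ≤ Q) :
    (Summable fun q : d → ℤ => (if (∀ l', l' ≠ l → q l' = 0) then ω₁ * |(q l : ℝ)| else 2 * M₀) *
      ‖mFourierCoeff (fun x : UnitAddTorus d => ((X.onCircle (x l) : ℝ) : ℂ)) q‖) ∧
    ∑' q : d → ℤ, (if (∀ l', l' ≠ l → q l' = 0) then ω₁ * |(q l : ℝ)| else 2 * M₀) *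
      ‖mFourierCoeff (fun x : UnitAddTorus d => ((X.onCircle (x l) : ℝ) : ℂ)) q‖ ≤
      ω₁ * (1 / (2 * Real.pi) * (Real.sqrt (2 * Q) *
        Real.sqrt ((2 * C₁ * (M + 4) * (2 * Real.pi * P.N j / P.δ j)) ^ 2 * (4 * M * P.δ j / Real.pi)) +
        Real.sqrt (((4 * C₂ * (M + 4) ^ 2 + 2 * C₁ * (2 * M ^ 2 + 33)) * (2 * Real.pi * P.N j / P.δ j) ^ 2) ^ 2 *
          (4 * M * P.δ j / Real.pi)) / ((P.N j : ℝ) * (Real.pi * Real.sqrt (2 * Q))))) := by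
  have hXf : (⇑X : ℝ → ℝ) = fun y => smoothTransition ((-deriv (P.U j) y - (1 - 2 * ε)) / ε) := funext hX
  obtain ⟨h1, h2⟩ := setIntegral_sq_derivs_cutoff_neg_le P hδ hN hε hε2 hM hMε hMδ hC₁ hC₂
  rw [← hXf] at h1 h2
  have hXN : ∀ y, X (y + 1 / P.N j) = X y := fun y => by rw [hX, hX, deriv_U_add_inv_N P hN]
  have hN1 : 1 ≤ P.N j := Nat.one_le_iff_ne_zero.mpr hN
  exact tsum_modulus_mul_norm_mFourierCoeff_onCircle_le_periodic X l hN1 hXN hω₁ h1 h2 hQ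

end Summit.AnomalousDissipation.AnomalousDissipation.Theorems.SawtoothPulseCascade.K1Cutoff
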